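import Literature.Computability.Complexity.HardcoreInapproximabilityMWWRate
import Literature.Computability.Complexity.HardcoreInapproximabilitySecondMomentUnique
import HarnessLib

/-!
# Sly's Condition 1.2 in the overlap parametrisation: the second-moment rate has a unique maximum

For densities `(α, β)` and overlap parameters `c = (γ, δ, ε)` of a pair of hard-core configurations on
the random bipartite `d`-regular graph, the rate of the second-moment summand is
`f(α,β;c) = slyRate d α β γ δ ε` (file `HardcoreInapproximabilityMWWRate`). This file links `f` to the
table functional `Ψ₂` of Galanis–Štefankovič–Vigoda (file `…SecondMomentBound/Unique`) and deduces
Sly's Condition 1.2 in the `(γ,δ,ε)`-form used by the Laplace analysis of the second moment: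

* `slyPairTable`, `slyFhat`, `slyPsi2` — the 16-cell pair table `x(c, f)` of an overlap class, the
  entropy-maximising fourth parameter `f̂(c) = (α-γ)(β-δ)/(1-β-γ-ε)`, and `Ψ₂`;
* `slyPsi2_pairTable_fhat` — **`Ψ₂(x(c, f̂(c))) = 2Φ₁(α,β) + f(α,β;c)`** on the overlap polytope
  (an exact identity of `u log u` terms; the four `f̂`-cells form a `2 × 2` product);
* `slyRate_le_zero_of_fixedPoint` — at the dominant phase `(p⁺,p⁻)`: `f ≤ 0` on the polytope with
  equality only at the product point `c* = (p⁺², p⁻², p⁺(1-p⁺-p⁻))`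
  (`pair_table_entropy_le_two_slyPhi1` + `pair_table_eq_product_of_entropy_eq`);
* `slyRate_gap_at_fixedPoint`, `slyRate_gap_near_fixedPoint` — compactness upgrades: a gap
  `f ≤ -η` outside any ball around `c*`, uniformly for `(α, β)` near `(p⁺, p⁻)`
  (`slyPolytope`, `slyCstar`, continuity of `f` in all five densities).

## References
* [Sly2010] A. Sly, *Computational transition at the uniqueness threshold*, FOCS 2010 /
  arXiv:1005.5584: Condition 1.2, §3.2 (Lemma 3.5), §3.3 (proof of Theorem 3.10).
* [GalanisStefankovicVigoda2015] A. Galanis, D. Štefankovič, E. Vigoda, *Inapproximability for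
  antiferromagnetic spin systems in the tree non-uniqueness region*, J. ACM 62 (2015), §3
  (second moment via matrix norms).
* [MosselWeitzWormald2008] E. Mossel, D. Weitz, N. Wormald, PTRF 143 (2009), §5.
-/

namespace Literature.Computability.Complexity

open Real Finset

section PairTable

variable (α β γ δ ε f : ℝ)

/-- The 16 cells of the **pair table** of the overlap class `(γ, δ, ε, f)`: `slyPairCell i k j l` is
the fraction of edges of one perfect matching joining a plus vertex of pair-type `(i,k)`
(`i` = occupied in `σ`, `k` = occupied in `τ`) to a minus vertex of pair-type `(j,l)`; the seven
cells with `i = j = 1` or `k = l = 1` are empty. Here `γ, δ` are the overlaps, `ε` the fraction of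
`σ`-only plus vertices matched into free minus vertices and `f` the fraction of `τ`-only plus
vertices matched into `σ`-only minus vertices. [cite: MosselWeitzWormald2008, §5 (the events defining `Ψ₂`); Sly2010, §3.2] -/
noncomputable def slyPairCell : Fin 2 → Fin 2 → Fin 2 → Fin 2 → ℝ :=
  fun i k j l =>
    ![![![![1 - 2 * β + δ - γ - ε - (α - γ - f), β - δ - (α - γ - ε)], ![β - δ - f, δ]],
        ![![α - γ - f, 0], ![f, 0]]],
      ![![![ε, α - γ - ε], ![0, 0]], ![![γ, 0], ![0, 0]]]] i k j l

/-- The pair table as a function of plus pair-type `a = (i,k)` and minus pair-type `b = (j,l)`.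
[cite: MosselWeitzWormald2008, §5] -/
noncomputable def slyPairTable (a b : Fin 2 × Fin 2) : ℝ :=
  slyPairCell α β γ δ ε f a.1 a.2 b.1 b.2

/-- The entropy-maximising value `f̂ = (α-γ)(β-δ)/(1-β-γ-ε)` of the fourth overlap parameter
(the mode of the Vandermonde convolution in the third event of `Ψ₂`). [cite: MosselWeitzWormald2008, §5] -/
noncomputable def slyFhat : ℝ := (α - γ) * (β - δ) / (1 - β - γ - ε)

/-- **The second-moment functional** of Galanis–Štefankovič–Vigoda for a pair table `x`:
`Ψ₂(x) = d Σ x log(B⊗B / x) + (d-1)(Σ r log r + Σ c log c)`. [cite: GalanisStefankovicVigoda2015, §3 (the function `Ψ₂`)] -/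
noncomputable def slyPsi2 (d : ℕ) (lam : ℝ) (x : Fin 2 × Fin 2 → Fin 2 × Fin 2 → ℝ) : ℝ :=
  (d : ℝ) * ∑ a, ∑ b, x a b *
      (Real.log (slyBlam d lam a.1 b.1 * slyBlam d lam a.2 b.2) - Real.log (x a b)) +
    ((d : ℝ) - 1) * (∑ a, (∑ b, x a b) * Real.log (∑ b, x a b) +
      ∑ b, (∑ a, x a b) * Real.log (∑ a, x a b))

end PairTable

section Cells

variable (α β γ δ ε f : ℝ)

/-- The cells of the pair table, row `(0,0)`. [folklore] -/
theorem slyPairTable_00 :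
    slyPairTable α β γ δ ε f (0, 0) (0, 0) = 1 - 2 * β + δ - γ - ε - (α - γ - f) ∧
      slyPairTable α β γ δ ε f (0, 0) (0, 1) = β - δ - (α - γ - ε) ∧
        slyPairTable α β γ δ ε f (0, 0) (1, 0) = β - δ - f ∧
          slyPairTable α β γ δ ε f (0, 0) (1, 1) = δ := by
  refine ⟨?_, ?_, ?_, ?_⟩ <;> simp [slyPairTable, slyPairCell]

/-- The cells of the pair table, row `(0,1)`. [folklore] -/
theorem slyPairTable_01 :
    slyPairTable α β γ δ ε f (0, 1) (0, 0) = α - γ - f ∧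
      slyPairTable α β γ δ ε f (0, 1) (0, 1) = 0 ∧
        slyPairTable α β γ δ ε f (0, 1) (1, 0) = f ∧
          slyPairTable α β γ δ ε f (0, 1) (1, 1) = 0 := by
  refine ⟨?_, ?_, ?_, ?_⟩ <;> simp [slyPairTable, slyPairCell]

/-- The cells of the pair table, row `(1,0)`. [folklore] -/
theorem slyPairTable_10 :
    slyPairTable α β γ δ ε f (1, 0) (0, 0) = ε ∧
      slyPairTable α β γ δ ε f (1, 0) (0, 1) = α - γ - ε ∧
        slyPairTable α β γ δ ε f (1, 0) (1, 0) = 0 ∧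
          slyPairTable α β γ δ ε f (1, 0) (1, 1) = 0 := by
  refine ⟨?_, ?_, ?_, ?_⟩ <;> simp [slyPairTable, slyPairCell]

/-- The cells of the pair table, row `(1,1)`. [folklore] -/
theorem slyPairTable_11 :
    slyPairTable α β γ δ ε f (1, 1) (0, 0) = γ ∧
      slyPairTable α β γ δ ε f (1, 1) (0, 1) = 0 ∧
        slyPairTable α β γ δ ε f (1, 1) (1, 0) = 0 ∧
          slyPairTable α β γ δ ε f (1, 1) (1, 1) = 0 := by
  refine ⟨?_, ?_, ?_, ?_⟩ <;> simp [slyPairTable, slyPairCell]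

/-- Expanding a sum over pair-types. [folklore] -/
theorem sum_pairType (F : Fin 2 × Fin 2 → ℝ) :
    ∑ a, F a = F (0, 0) + F (0, 1) + F (1, 0) + F (1, 1) := by
  rw [Fintype.sum_prod_type]
  simp [Fin.sum_univ_two]
  ring

/-- Row marginals of the pair table (plus pair-types): `(1-2α+γ, α-γ, α-γ, γ)`. [folklore] -/
theorem slyPairTable_rowsum (a : Fin 2 × Fin 2) :
    ∑ b, slyPairTable α β γ δ ε f a b = ![![1 - α - (α - γ), α - γ], ![α - γ, γ]] a.1 a.2 := by
  obtain ⟨i, k⟩ := a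
  rw [sum_pairType]
  fin_cases i <;> fin_cases k <;>
    simp only [slyPairTable, slyPairCell, Fin.isValue, Fin.zero_eta, Fin.mk_one, Matrix.cons_val_zero,
      Matrix.cons_val_one] <;> ring

/-- Column marginals of the pair table (minus pair-types): `(1-2β+δ, β-δ, β-δ, δ)`. [folklore] -/
theorem slyPairTable_colsum (b : Fin 2 × Fin 2) :
    ∑ a, slyPairTable α β γ δ ε f a b = ![![1 - 2 * β + δ, β - δ], ![β - δ, δ]] b.1 b.2 := by
  obtain ⟨j, l⟩ := b
  rw [sum_pairType]
  fin_cases j <;> fin_cases l <;>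
    simp only [slyPairTable, slyPairCell, Fin.isValue, Fin.zero_eta, Fin.mk_one, Matrix.cons_val_zero,
      Matrix.cons_val_one] <;> ring

/-- The pair table has total mass `1`. [folklore] -/
theorem slyPairTable_sum : ∑ a, ∑ b, slyPairTable α β γ δ ε f a b = 1 := by
  simp_rw [slyPairTable_rowsum]
  rw [sum_pairType]
  simp only [Matrix.cons_val_zero, Matrix.cons_val_one]
  ring

/-- Layer marginals of the pair table: `σ`-occupancy of plus vertices. [folklore] -/
theorem slyPairTable_marg1 (i : Fin 2) :
    ∑ k, ∑ b, slyPairTable α β γ δ ε f (i, k) b = ![1 - α, α] i := by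
  simp_rw [slyPairTable_rowsum]
  fin_cases i <;>
    simp only [Fin.sum_univ_two, Fin.isValue, Fin.zero_eta, Fin.mk_one, Matrix.cons_val_zero,
      Matrix.cons_val_one] <;> ring

/-- Layer marginals of the pair table: `τ`-occupancy of plus vertices. [folklore] -/
theorem slyPairTable_marg2 (k : Fin 2) :
    ∑ i, ∑ b, slyPairTable α β γ δ ε f (i, k) b = ![1 - α, α] k := by
  simp_rw [slyPairTable_rowsum]
  fin_cases k <;>
    simp only [Fin.sum_univ_two, Fin.isValue, Fin.zero_eta, Fin.mk_one, Matrix.cons_val_zero,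
      Matrix.cons_val_one] <;> ring

/-- Layer marginals of the pair table: `σ`-occupancy of minus vertices. [folklore] -/
theorem slyPairTable_marg3 (j : Fin 2) :
    ∑ l, ∑ a, slyPairTable α β γ δ ε f a (j, l) = ![1 - β, β] j := by
  simp_rw [slyPairTable_colsum]
  fin_cases j <;>
    simp only [Fin.sum_univ_two, Fin.isValue, Fin.zero_eta, Fin.mk_one, Matrix.cons_val_zero,
      Matrix.cons_val_one] <;> ring

/-- Layer marginals of the pair table: `τ`-occupancy of minus vertices. [folklore] -/
theorem slyPairTable_marg4 (l : Fin 2) :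
    ∑ j, ∑ a, slyPairTable α β γ δ ε f a (j, l) = ![1 - β, β] l := by
  simp_rw [slyPairTable_colsum]
  fin_cases l <;>
    simp only [Fin.sum_univ_two, Fin.isValue, Fin.zero_eta, Fin.mk_one, Matrix.cons_val_zero,
      Matrix.cons_val_one] <;> ring

/-- The pair table is supported on compatible pairs. [folklore] -/
theorem slyPairTable_supp (a b : Fin 2 × Fin 2) (h : 0 < slyPairTable α β γ δ ε f a b) :
    ¬(a.1 = 1 ∧ b.1 = 1) ∧ ¬(a.2 = 1 ∧ b.2 = 1) := by
  obtain ⟨i, k⟩ := a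
  obtain ⟨j, l⟩ := b
  fin_cases i <;> fin_cases k <;> fin_cases j <;> fin_cases l <;>
    simp [slyPairTable, slyPairCell] at h ⊢

end Cells

section Fhat

/-- `u log u = u (log p + log q - log T)` when `u = pq/T` with `p, q ≥ 0 < T` (both sides vanish
when `pq = 0`). [folklore] -/
theorem mul_log_eq_of_eq_mul_div {u p q T : ℝ} (hT : 0 < T) (hu : u = p * q / T) :
    u * Real.log u = u * (Real.log p + Real.log q - Real.log T) := by
  by_cases hp : p = 0
  · simp [hu, hp]
  by_cases hq : q = 0
  · simp [hu, hq]
  rw [hu, Real.log_div (mul_ne_zero hp hq) hT.ne', Real.log_mul hp hq]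

variable {α β γ δ ε : ℝ}

/-- The four `f̂`-cells are the product cells `PA/T, P·Fr/T, A·R/T, Fr·R/T`. [folklore] -/
theorem slyFhat_cells (hT : 1 - β - γ - ε ≠ 0) :
    α - γ - slyFhat α β γ δ ε = (α - γ) * (1 - 2 * β + δ - γ - ε) / (1 - β - γ - ε) ∧
      β - δ - slyFhat α β γ δ ε = (β - δ) * (1 - β - γ - ε - (α - γ)) / (1 - β - γ - ε) ∧
        1 - 2 * β + δ - γ - ε - (α - γ - slyFhat α β γ δ ε) =
          (1 - 2 * β + δ - γ - ε) * (1 - β - γ - ε - (α - γ)) / (1 - β - γ - ε) := by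
  unfold slyFhat
  refine ⟨?_, ?_, ?_⟩ <;> field_simp <;> ring

/-- On the overlap polytope (with `α + β < 1`) the normaliser `T = 1-β-γ-ε` is positive. [folklore] -/
theorem slyT_pos (hαβ : α + β < 1) (hE1 : 0 ≤ α - γ - ε) : 0 < 1 - β - γ - ε := by
  linarith

/-- The pair table at `f = f̂` is nonnegative on the overlap polytope. [folklore] -/
theorem slyPairTable_fhat_nonneg (hαβ : α + β < 1) (hγ : 0 ≤ γ) (hε : 0 ≤ ε) (hδ : 0 ≤ δ)
    (hE1 : 0 ≤ α - γ - ε) (hQ : 0 ≤ β - δ - (α - γ - ε)) (hFr : 0 ≤ 1 - 2 * β + δ - γ - ε)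
    (hR : 0 ≤ 1 - β - γ - ε - (α - γ)) (a b : Fin 2 × Fin 2) :
    0 ≤ slyPairTable α β γ δ ε (slyFhat α β γ δ ε) a b := by
  have hT := slyT_pos hαβ hE1
  have hP : 0 ≤ α - γ := by linarith
  have hA : 0 ≤ β - δ := by linarith
  obtain ⟨c1, c2, c3⟩ := slyFhat_cells (α := α) (β := β) (γ := γ) (δ := δ) (ε := ε) hT.ne'
  have hf0 : 0 ≤ slyFhat α β γ δ ε := by unfold slyFhat; positivity
  have hf1 : 0 ≤ α - γ - slyFhat α β γ δ ε := by rw [c1]; positivity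
  have hf2 : 0 ≤ β - δ - slyFhat α β γ δ ε := by rw [c2]; positivity
  have hf3 : 0 ≤ 1 - 2 * β + δ - γ - ε - (α - γ - slyFhat α β γ δ ε) := by rw [c3]; positivity
  obtain ⟨i, k⟩ := a
  obtain ⟨j, l⟩ := b
  fin_cases i <;> fin_cases k <;> fin_cases j <;> fin_cases l <;>
    simp [slyPairTable, slyPairCell] <;> linarith

end Fhat

section Identity

variable {d : ℕ} {lam α β γ δ ε : ℝ}

set_option maxHeartbeats 4000000 in
/-- **The pair table realises the second-moment rate**: at `f = f̂(c)`,
`Ψ₂(x(c, f̂)) = 2 Φ₁(α, β) + f(α, β; γ, δ, ε)` on the overlap polytope — the link between the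
(γ,δ,ε)-parametrised second moment of Mossel–Weitz–Wormald / Sly and the table functional of
Galanis–Štefankovič–Vigoda. [cite: Sly2010, §3.2 (Lemma 3.5 and Condition 1.2); GalanisStefankovicVigoda2015, §3] -/
theorem slyPsi2_pairTable_fhat (hd : 1 ≤ d) (hlam : 0 < lam) (hT : 0 < 1 - β - γ - ε) :
    slyPsi2 d lam (slyPairTable α β γ δ ε (slyFhat α β γ δ ε)) =
      2 * slyPhi1 d lam α β + slyRate d α β γ δ ε := by
  -- the right-hand side in atoms
  have TA1 := entB_val (X := (α : ℝ)) (Y := (γ : ℝ)) rfl rfl rfl rfl rfl rfl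
  have TA2 := entB_val (X := (1 - α : ℝ)) (Y := (α - γ : ℝ)) rfl rfl rfl rfl rfl rfl
  have TA3 := entB_val (X := (1 : ℝ)) (Y := (α : ℝ)) rfl rfl rfl Real.log_one rfl rfl
  have TA4 := entB_val (X := (β : ℝ)) (Y := (δ : ℝ)) rfl rfl rfl rfl rfl rfl
  have TA5 := entB_val (X := (1 - β : ℝ)) (Y := (β - δ : ℝ)) rfl rfl
    (by ring : (1 - β : ℝ) - (β - δ) = 1 - 2 * β + δ) rfl rfl rfl
  have TA6 := entB_val (X := (1 : ℝ)) (Y := (β : ℝ)) rfl rfl rfl Real.log_one rfl rfl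
  have TB1 := entB_val (X := (1 - 2 * β + δ : ℝ)) (Y := (γ : ℝ)) rfl rfl rfl rfl rfl rfl
  have TB2 := entB_val (X := (1 : ℝ)) (Y := (γ : ℝ)) rfl rfl rfl Real.log_one rfl rfl
  have TB3 := entB_val (X := (1 - 2 * β + δ - γ : ℝ)) (Y := (ε : ℝ)) rfl rfl rfl rfl rfl rfl
  have TB4 := entB_val (X := (β - δ : ℝ)) (Y := (α - γ - ε : ℝ)) rfl rfl rfl rfl rfl rfl
  have TB5 := entB_val (X := (1 - γ : ℝ)) (Y := (α - γ : ℝ)) rfl rfl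
    (by ring : (1 - γ : ℝ) - (α - γ) = 1 - α) rfl rfl rfl
  have TB6 := entB_val (X := (1 - β - γ - ε : ℝ)) (Y := (α - γ : ℝ)) rfl rfl rfl rfl rfl rfl
  have TP1 := entB_val (X := (1 - β : ℝ)) (Y := (α : ℝ)) rfl rfl
    (by ring : (1 - β : ℝ) - α = 1 - α - β) rfl rfl rfl
  -- the four `f̂`-cells
  obtain ⟨c1, c2, c3⟩ := slyFhat_cells (α := α) (β := β) (γ := γ) (δ := δ) (ε := ε) hT.ne'
  have hf0 := mul_log_eq_of_eq_mul_div (p := α - γ) (q := β - δ) hT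
    (rfl : slyFhat α β γ δ ε = (α - γ) * (β - δ) / (1 - β - γ - ε))
  have hf1 := mul_log_eq_of_eq_mul_div hT c1
  have hf2 := mul_log_eq_of_eq_mul_div hT c2
  have hf3 := mul_log_eq_of_eq_mul_div hT c3
  -- the energy logarithms
  have hr0 : (0 : ℝ) < lam ^ (1 / (d : ℝ)) := Real.rpow_pos_of_pos hlam _
  have hL1 : Real.log (lam ^ (1 / (d : ℝ))) = Real.log lam / d := by
    rw [Real.log_rpow hlam]; ring
  have hL2 : Real.log (lam ^ (1 / (d : ℝ)) * lam ^ (1 / (d : ℝ))) = 2 * (Real.log lam / d) := by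
    rw [Real.log_mul hr0.ne' hr0.ne', hL1]; ring
  -- expand the functional
  unfold slyPsi2
  simp_rw [slyPairTable_rowsum, slyPairTable_colsum]
  simp only [sum_pairType]
  simp only [slyPairTable, slyPairCell, slyBlam, Matrix.cons_val_zero, Matrix.cons_val_one,
    Fin.isValue, zero_ne_one, and_self, and_true, and_false, if_true, if_false, Fin.val_zero,
    Fin.val_one, Nat.cast_zero, Nat.cast_one, add_zero, zero_add, zero_div, Real.rpow_zero,
    mul_one, one_mul, zero_mul, Real.log_one]
  rw [hL2, hL1]
  -- the right-hand side
  unfold slyRate slyFA slyFB slyPsi1 slyPhi1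
  rw [TA1, TA2, TA3, TA4, TA5, TA6, TB1, TB2, TB3, TB4, TB5, TB6, TP1]
  -- the `f̂`-cells' `u log u`
  have e0 : slyFhat α β γ δ ε = (α - γ) * (β - δ) / (1 - β - γ - ε) := rfl
  rw [mul_sub (slyFhat α β γ δ ε), hf0, mul_sub (α - γ - slyFhat α β γ δ ε), hf1,
    mul_sub (β - δ - slyFhat α β γ δ ε), hf2,
    mul_sub (1 - 2 * β + δ - γ - ε - (α - γ - slyFhat α β γ δ ε)), hf3]
  rw [e0]
  have hT' : (1 - β - γ - ε) ≠ 0 := hT.ne'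
  have hd' : (d : ℝ) ≠ 0 := by exact_mod_cast (by omega : d ≠ 0)
  field_simp
  ring

end Identity

section Unique

open Literature.Probability.LatticeModels

variable {d : ℕ} {lam pp pm γ δ ε : ℝ}

/-- **Uniqueness of the maximum of the second-moment rate** (Sly's Condition 1.2 in the
`(γ,δ,ε)`-parametrisation, from the Galanis–Štefankovič–Vigoda matrix-norm bound): at the dominant
phase `(p⁺,p⁻)` and for every point of the overlap polytope, `f(p⁺,p⁻; γ,δ,ε) ≤ 0`, with equality
only at the product point `(p⁺², p⁻², p⁺(1-p⁺-p⁻))`. [cite: Sly2010, Condition 1.2 and Lemma 3.5; GalanisStefankovicVigoda2015, Theorem 2 (second-moment analysis via matrix norms)] -/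
theorem slyRate_le_zero_of_fixedPoint (hd : 3 ≤ d) (hlam : hardCoreThreshold d < lam)
    (hpm : 0 < pm) (hlt : pm < pp) (hsum : pp + pm < 1)
    (hEα : lam * (1 - pp - pm) ^ d = pp * (1 - pp) ^ (d - 1))
    (hEβ : lam * (1 - pp - pm) ^ d = pm * (1 - pm) ^ (d - 1))
    (hγ : 0 ≤ γ) (hε : 0 ≤ ε) (hδ : 0 ≤ δ) (hE1 : 0 ≤ pp - γ - ε)
    (hQ : 0 ≤ pm - δ - (pp - γ - ε)) (hFr : 0 ≤ 1 - 2 * pm + δ - γ - ε)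
    (hR : 0 ≤ 1 - pm - γ - ε - (pp - γ)) :
    slyRate d pp pm γ δ ε ≤ 0 ∧
      (slyRate d pp pm γ δ ε = 0 → γ = pp ^ 2 ∧ δ = pm ^ 2 ∧ ε = pp * (1 - pp - pm)) := by
  have hlam0 : 0 < lam := (hardCoreThreshold_pos hd).trans hlam
  have hd1 : 1 ≤ d := by omega
  have hT := slyT_pos (β := pm) hsum hE1
  set x := slyPairTable pp pm γ δ ε (slyFhat pp pm γ δ ε) with hx
  have hx0 := slyPairTable_fhat_nonneg hsum hγ hε hδ hE1 hQ hFr hR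
  have hx1 := slyPairTable_sum pp pm γ δ ε (slyFhat pp pm γ δ ε)
  have hsupp := slyPairTable_supp pp pm γ δ ε (slyFhat pp pm γ δ ε)
  have hid := slyPsi2_pairTable_fhat (d := d) (α := pp) (δ := δ) hd1 hlam0 hT
  have hΨ : slyPsi2 d lam x ≤ 2 * slyPhi1 d lam pp pm :=
    pair_table_entropy_le_two_slyPhi1 hd hlam hpm hlt hsum hEα hEβ x hx0 hx1 hsupp
  rw [hx, hid] at hΨ
  refine ⟨by linarith, fun h0 => ?_⟩
  have heq : slyPsi2 d lam x = 2 * slyPhi1 d lam pp pm := by rw [hx, hid, h0, add_zero]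
  have hprod := pair_table_eq_product_of_entropy_eq hd hlam hpm hlt hsum hEα hEβ x hx0 hx1 hsupp
    (slyPairTable_marg1 pp pm γ δ ε _) (slyPairTable_marg2 pp pm γ δ ε _)
    (slyPairTable_marg3 pp pm γ δ ε _) (slyPairTable_marg4 pp pm γ δ ε _) heq
  obtain ⟨t00, t01, t10, t11⟩ := slyTable1_apply pp pm
  have h1 := hprod (1, 1) (0, 0)
  have h2 := hprod (0, 0) (1, 1)
  have h3 := hprod (1, 0) (0, 0)
  rw [hx] at h1 h2 h3
  simp only at h1 h2 h3
  rw [(slyPairTable_11 pp pm γ δ ε _).1, t10] at h1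
  rw [(slyPairTable_00 pp pm γ δ ε _).2.2.2, t01] at h2
  rw [(slyPairTable_10 pp pm γ δ ε _).1, t10, t00] at h3
  exact ⟨by rw [h1]; ring, by rw [h2]; ring, h3⟩

end Unique

section FarField

open Literature.Probability.LatticeModels Topology Filter

/-- `entB` is jointly continuous along continuous arguments (`u ↦ u log u` is continuous).
[folklore] -/
@[fun_prop]
theorem continuous_entB_comp {X : Type*} [TopologicalSpace X] {f g : X → ℝ} (hf : Continuous f)
    (hg : Continuous g) : Continuous fun x => entB (f x) (g x) := by
  unfold entB
  exact ((Real.continuous_mul_log.comp hf).sub (Real.continuous_mul_log.comp hg)).sub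
    (Real.continuous_mul_log.comp (hf.sub hg))

/-- The second-moment rate is continuous in all five densities. [folklore] -/
theorem continuous_slyRate₅ (d : ℕ) :
    Continuous fun z : ℝ × ℝ × ℝ × ℝ × ℝ => slyRate d z.1 z.2.1 z.2.2.1 z.2.2.2.1 z.2.2.2.2 := by
  unfold slyRate slyFA slyFB slyPsi1
  fun_prop

/-- **The overlap polytope** of `(γ, δ, ε)` for densities `(α, β)`: the seven cell constraints under
which some pair table exists. [cite: MosselWeitzWormald2008, §5 (e:greekRegion); Sly2010, §3.2] -/
def slyPolytope (α β : ℝ) : Set (ℝ × ℝ × ℝ) :=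
  {c | 0 ≤ c.1 ∧ 0 ≤ c.2.2 ∧ 0 ≤ c.2.1 ∧ 0 ≤ α - c.1 - c.2.2 ∧
    0 ≤ β - c.2.1 - (α - c.1 - c.2.2) ∧ 0 ≤ 1 - 2 * β + c.2.1 - c.1 - c.2.2 ∧
    0 ≤ 1 - β - c.1 - c.2.2 - (α - c.1)}

/-- The product point `c* = (α², β², α(1-α-β))`. [cite: MosselWeitzWormald2008, Lemma 5.2] -/
def slyCstar (α β : ℝ) : ℝ × ℝ × ℝ := (α ^ 2, β ^ 2, α * (1 - α - β))

/-- The overlap polytope is closed. [folklore] -/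
theorem isClosed_slyPolytope (α β : ℝ) : IsClosed (slyPolytope α β) := by
  unfold slyPolytope
  simp only [Set.setOf_and]
  repeat' apply IsClosed.inter
  all_goals exact isClosed_le continuous_const (by fun_prop)

/-- The overlap polytope lies in the unit cube (for `α, β ≤ 1`). [folklore] -/
theorem slyPolytope_subset_Icc {α β : ℝ} (hα : α ≤ 1) (hβ : β ≤ 1) :
    slyPolytope α β ⊆ Set.Icc ((0 : ℝ), (0 : ℝ), (0 : ℝ)) (1, 1, 1) := by
  rintro ⟨γ, δ, ε⟩ ⟨h1, h2, h3, h4, h5, h6, h7⟩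
  simp only [Set.mem_Icc, Prod.mk_le_mk]
  dsimp only at h1 h2 h3 h4 h5 h6 h7
  refine ⟨⟨h1, h3, h2⟩, ?_, ?_, ?_⟩ <;> linarith

variable {d : ℕ} {lam pp pm : ℝ}

/-- **Gap away from the product point, at the dominant phase**: for every `r₀ > 0` there is `η > 0`
with `f(p⁺,p⁻; c) ≤ -η` on the overlap polytope outside the `r₀`-ball around `c*`.
[cite: Sly2010, §3.2 (Condition 1.2 ⇒ Lemma 3.5)] -/
theorem slyRate_gap_at_fixedPoint (hd : 3 ≤ d) (hlam : hardCoreThreshold d < lam)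
    (hpm : 0 < pm) (hlt : pm < pp) (hsum : pp + pm < 1)
    (hEα : lam * (1 - pp - pm) ^ d = pp * (1 - pp) ^ (d - 1))
    (hEβ : lam * (1 - pp - pm) ^ d = pm * (1 - pm) ^ (d - 1)) {r₀ : ℝ} (hr₀ : 0 < r₀) :
    ∃ η : ℝ, 0 < η ∧ ∀ c ∈ slyPolytope pp pm, r₀ ≤ dist c (slyCstar pp pm) →
      slyRate d pp pm c.1 c.2.1 c.2.2 ≤ -η := by
  set K : Set (ℝ × ℝ × ℝ) := slyPolytope pp pm ∩ {c | r₀ ≤ dist c (slyCstar pp pm)} with hK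
  have hKc : IsClosed K :=
    (isClosed_slyPolytope pp pm).inter (isClosed_le continuous_const (by fun_prop))
  have hKcpt : IsCompact K :=
    (isCompact_Icc (a := ((0 : ℝ), (0 : ℝ), (0 : ℝ))) (b := (1, 1, 1))).of_isClosed_subset hKc
      (Set.inter_subset_left.trans (slyPolytope_subset_Icc (by linarith) (by linarith)))
  have hcont : Continuous fun c : ℝ × ℝ × ℝ => slyRate d pp pm c.1 c.2.1 c.2.2 :=
    (continuous_slyRate₅ d).comp (by fun_prop : Continuous fun c : ℝ × ℝ × ℝ => (pp, pm, c))
  have hFF1 : ∀ c ∈ slyPolytope pp pm, slyRate d pp pm c.1 c.2.1 c.2.2 ≤ 0 ∧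
      (slyRate d pp pm c.1 c.2.1 c.2.2 = 0 → c = slyCstar pp pm) := by
    rintro ⟨γ, δ, ε⟩ ⟨h1, h2, h3, h4, h5, h6, h7⟩
    dsimp only at h1 h2 h3 h4 h5 h6 h7 ⊢
    obtain ⟨hle, heq⟩ := slyRate_le_zero_of_fixedPoint hd hlam hpm hlt hsum hEα hEβ h1 h2 h3 h4
      h5 h6 h7
    refine ⟨hle, fun h0 => ?_⟩
    obtain ⟨e1, e2, e3⟩ := heq h0
    simp only [slyCstar, e1, e2, e3]
  by_cases hne : K.Nonempty
  · obtain ⟨c₀, hc₀, hmax⟩ := hKcpt.exists_isMaxOn hne hcont.continuousOn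
    have hM := (hFF1 c₀ hc₀.1).1
    have hM0 : slyRate d pp pm c₀.1 c₀.2.1 c₀.2.2 ≠ 0 := by
      intro h0
      have := (hFF1 c₀ hc₀.1).2 h0
      have hdist : r₀ ≤ dist c₀ (slyCstar pp pm) := hc₀.2
      rw [this, dist_self] at hdist
      linarith
    refine ⟨-slyRate d pp pm c₀.1 c₀.2.1 c₀.2.2, by
      rcases lt_or_eq_of_le hM with h | h
      · linarith
      · exact absurd h hM0, ?_⟩
    intro c hc hfar
    have := hmax ⟨hc, hfar⟩
    simp only [neg_neg]
    exact this
  · refine ⟨1, one_pos, fun c hc hfar => ?_⟩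
    exact absurd ⟨c, hc, hfar⟩ hne

/-- **Uniform gap near the dominant phase**: there are `χ, η > 0` such that for all densities
`(α, β)` within `χ` of `(p⁺, p⁻)` and all points of the overlap polytope of `(α, β)` outside the
`r₀`-ball around `c*(α, β)`, `f(α,β; c) ≤ -η` (compactness and continuity in all five variables).
[cite: Sly2010, §3.3 (proof of Theorem 3.10: "for `(α,β)` in a neighborhood of `(p⁻,p⁺)` … `g_{α,β}` achieves its unique maximum")] -/
theorem slyRate_gap_near_fixedPoint (hd : 3 ≤ d) (hlam : hardCoreThreshold d < lam)
    (hpm : 0 < pm) (hlt : pm < pp) (hsum : pp + pm < 1)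
    (hEα : lam * (1 - pp - pm) ^ d = pp * (1 - pp) ^ (d - 1))
    (hEβ : lam * (1 - pp - pm) ^ d = pm * (1 - pm) ^ (d - 1)) {r₀ : ℝ} (hr₀ : 0 < r₀) :
    ∃ χ : ℝ, 0 < χ ∧ ∃ η : ℝ, 0 < η ∧ ∀ α β : ℝ, |α - pp| ≤ χ → |β - pm| ≤ χ →
      ∀ c ∈ slyPolytope α β, r₀ ≤ dist c (slyCstar α β) →
        slyRate d α β c.1 c.2.1 c.2.2 ≤ -η := by
  obtain ⟨η₁, hη₁, hgap⟩ := slyRate_gap_at_fixedPoint hd hlam hpm hlt hsum hEα hEβ hr₀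
  -- a fixed outer radius `χ₀` keeping `α, β ≤ 1`
  set χ₀ : ℝ := (1 - pp - pm) / 2 with hχ₀
  have hχ₀p : 0 < χ₀ := by rw [hχ₀]; linarith
  -- the compact set of all far feasible 5-tuples with `(α,β)` within `χ₀`
  set 𝓚 : Set (ℝ × ℝ × ℝ × ℝ × ℝ) :=
    {z | |z.1 - pp| ≤ χ₀ ∧ |z.2.1 - pm| ≤ χ₀ ∧ z.2.2 ∈ slyPolytope z.1 z.2.1 ∧
      r₀ ≤ dist z.2.2 (slyCstar z.1 z.2.1)} with h𝓚
  have hF : Continuous fun z : ℝ × ℝ × ℝ × ℝ × ℝ => slyRate d z.1 z.2.1 z.2.2.1 z.2.2.2.1 z.2.2.2.2 :=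
    continuous_slyRate₅ d
  have hclosed : IsClosed 𝓚 := by
    rw [h𝓚]
    simp only [slyPolytope, slyCstar, Set.setOf_and]
    repeat' apply IsClosed.inter
    all_goals first
      | exact isClosed_le continuous_const (by fun_prop)
      | exact isClosed_le (by fun_prop) continuous_const
  have hsub : 𝓚 ⊆ Set.Icc ((pp - χ₀, pm - χ₀, 0, 0, 0) : ℝ × ℝ × ℝ × ℝ × ℝ)
      (pp + χ₀, pm + χ₀, 1, 1, 1) := by
    rintro ⟨α, β, γ, δ, ε⟩ ⟨hα, hβ, ⟨h1, h2, h3, h4, h5, h6, h7⟩, -⟩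
    dsimp only at hα hβ h1 h2 h3 h4 h5 h6 h7
    rw [abs_le] at hα hβ
    simp only [Set.mem_Icc, Prod.mk_le_mk]
    refine ⟨⟨by linarith, by linarith, h1, h3, h2⟩, by linarith, by linarith, ?_, ?_, ?_⟩ <;>
      linarith
  have hcpt : IsCompact 𝓚 := (isCompact_Icc).of_isClosed_subset hclosed hsub
  -- the bad set
  set Z : Set (ℝ × ℝ × ℝ × ℝ × ℝ) :=
    𝓚 ∩ {z | -(η₁ / 2) ≤ slyRate d z.1 z.2.1 z.2.2.1 z.2.2.2.1 z.2.2.2.2} with hZ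
  have hZcpt : IsCompact Z := hcpt.inter_right (isClosed_le continuous_const hF)
  have hg : Continuous fun z : ℝ × ℝ × ℝ × ℝ × ℝ => max |z.1 - pp| |z.2.1 - pm| := by fun_prop
  by_cases hne : Z.Nonempty
  · obtain ⟨z₀, hz₀, hmin⟩ := hZcpt.exists_isMinOn hne hg.continuousOn
    set m : ℝ := max |z₀.1 - pp| |z₀.2.1 - pm| with hm
    have hm0 : 0 < m := by
      by_contra hle
      push Not at hle
      have h1 : |z₀.1 - pp| = 0 := le_antisymm (le_trans (le_max_left _ _) hle) (abs_nonneg _)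
      have h2 : |z₀.2.1 - pm| = 0 := le_antisymm (le_trans (le_max_right _ _) hle) (abs_nonneg _)
      rw [abs_eq_zero, sub_eq_zero] at h1 h2
      obtain ⟨⟨-, -, hpoly, hfar⟩, hbad⟩ := hz₀
      rw [h1, h2] at hpoly hfar
      have := hgap _ hpoly hfar
      simp only [Set.mem_setOf_eq, h1, h2] at hbad
      linarith
    refine ⟨min χ₀ (m / 2), lt_min hχ₀p (by positivity), η₁ / 2, by positivity, ?_⟩
    intro α β hα hβ c hc hfar
    have hα' : |α - pp| ≤ χ₀ := le_trans hα (min_le_left _ _)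
    have hβ' : |β - pm| ≤ χ₀ := le_trans hβ (min_le_left _ _)
    have hmem : ((α, β, c) : ℝ × ℝ × ℝ × ℝ × ℝ) ∈ 𝓚 := ⟨hα', hβ', hc, hfar⟩
    by_contra hlt'
    push Not at hlt'
    have hzZ : ((α, β, c) : ℝ × ℝ × ℝ × ℝ × ℝ) ∈ Z := ⟨hmem, by
      simp only [Set.mem_setOf_eq]; exact hlt'.le⟩
    have := hmin hzZ
    simp only at this
    have hlt2 : max |α - pp| |β - pm| < m :=
      max_lt (lt_of_le_of_lt hα (lt_of_le_of_lt (min_le_right _ _) (by linarith)))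
        (lt_of_le_of_lt hβ (lt_of_le_of_lt (min_le_right _ _) (by linarith)))
    exact absurd this (not_le.mpr hlt2)
  · refine ⟨χ₀, hχ₀p, η₁ / 2, by positivity, ?_⟩
    intro α β hα hβ c hc hfar
    by_contra hlt'
    push Not at hlt'
    exact hne ⟨(α, β, c), ⟨hα, hβ, hc, hfar⟩, by simp only [Set.mem_setOf_eq]; exact hlt'.le⟩

end FarField

end Literature.Computability.Complexity
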